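import Summits.HodgeConjecture.HodgeConjecture.Cruxes.BlochSeedDiscOne.SeedCheckerSplitBlockCFree
import Summits.HodgeConjecture.HodgeConjecture.Cruxes.BlochSeedDiscOne.PortHallPriceList
import Summits.HodgeConjecture.HodgeConjecture.Cruxes.BlochSeedDiscOne.ShellThreeClosed
import Summits.HodgeConjecture.HodgeConjecture.Cruxes.BlochSeedDiscOne.RowAlpha1RuleDSharp
import Summits.HodgeConjecture.HodgeConjecture.Cruxes.BlochSeedDiscOne.SheafDoorWindowBudget

/-!
line stmt-HodgeConjecture-18881 Cruxes/BlochSeedDiscOne/Lines/birth.lean 814a6a70c14e831a stub_rung_pad4_seedAt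

# ShellLedgerV42 — the SHELL LEDGER of the v42 kill hypothesis `hS : SplitBlock.SPlus₀ RD PP h σ π`
(plan-lens-HodgeAV-dual g22, 2026-09-01; clock-minted during the HodgeAV hibernation of LADDER-HodgeAV.md — NOT summoned; director-hodge
R19.862 (L2) «`StaticAlongTW₀ : SplitBlock.DatumLaw`» was re-assigned as R19.867 (L2′) and delivered by semihom-1 g68 (`StaticAlongTW.lean`,
`StaticAlongTWDatumLaw.lean`), so nothing was owed by this seat; kit 0; census effect NONE.)

KERNEL BOOKKEEPING ONLY — no `sorry`, no new axiom, no `instance`, no `notation`, no `decide` on designs, no `native_decide`.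
**Nothing here is proved toward HC ∕ HC_CM ∕ HC_AV ∕ №4 ∕ 26512 ∕ 18881 ∕ 30548 ∕ H2.**  Letters ≠ sheaves ≠ SEED.  `hS` is the HYPOTHESIS of the
registered kill theorems of `Lines/splitblock.lean` (`not_rung2a₀Under_recordPic_sigmaH` and twins: `hS : SPlus₀ LeggedFloor.RuleD lawPP 14 σ_H 0`)
and of the sheaf door's bridge (`SeedCheckerSplitBlockSheafBridge`: `hS : SPlus₀ RD PP h σ π`); it is NOT asserted here, and after this file its
shells `3 … 14` remain OPEN exactly as before (R19.853: caps `(58, 54, 112)`; (D1): no letter-room compute without a registered consumer).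

## WHY (J g70's currency caveat, ladder-directors INBOX l.24526; PRIOR PEN∕PROBE CREDIT: hsem-2 memo-180 §3 probe C)
The tree's shell ledgers (`DeepLayerLaws.RingRoomB ∕ RingShellB`, `ShellLedger`, `ShellThreeClosed` §5) are typed in the v41 currency, whose rows
hard-wire PortHall₈ (`HallPlusUp · 8`).  The v42 rows of record (`SplitBlock.ShadowRows₀`: α1 slot `RD`, Hall, LAW PP slot `PP`, the LEG row
`PortHallLeg.HallPlusLegUp`, the CHERN FLOOR `4 ≤ rank`, budget `σ + 28(rank − 4) + π ≤ 3136`) do NOT contain PortHall₈, and the tree compares the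
two currencies one way only (`shadowRows₀_of_shadowRows`, `sPlus_of_sPlus₀`: v42-closure ⟹ v41-closure).  That shells 1–2 are closed in the v42
currency too (any `RD ⟹ RULE D`, any `PP`, `σ ≥ 28·copies`, rider `0`) was kernel-checked FIRST by critic hsem-2, memo-180 §3 probe C
(`probe/ShellsV42KR180.lean` fb112f2d05d8b549 in that cell's folder, farm rc 0, NOT a tree module: `ring1_not_sieveRows₀`, `ring2_not_sieveRows₀`,
`line2_shells12`, `doorS_sigma_shells12`, `doorS_phi_shell1`); §2–§3 below are the TREE FORM of probe C (same two citations), widened to riders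
`π > −28`.  New here: the ROOM ∕ SHELL packaging and the ledger (§1, §4), the shell-3 residue (§5), the two-way transfer and the exact difference of
the currencies (§6), monotonicity (§7).  The file types the ledger natively in the v42 currency, so that «which shells of `hS` are closed, at what
price, and what exactly is left» is a kernel statement about `hS` itself:

* §1 the v42 RING ROOM ∕ RING SHELL `RingRoom₀ ∕ RingShell₀ RD PP h σ π c` (the room of `SPlus₀` cut down to the rings `≤ c` ∕ touching ring `c` on
  the P side), the ledger step `RingRoom₀ (c+1) ↔ RingRoom₀ c ∧ RingShell₀ (c+1)` (needs only `RD ⟹ RULE D`, for `DeepLayerLaws.ringLe_of_not_touchesP`),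
  ring `0` empty, and `SPlus₀ ↔ ⋀_{1 ≤ c ≤ h} RingShell₀ c`;
* §2 SHELL 1 CLOSED for every `RD ⟹ RULE D`, every `PP`, `σ`, `π` (`RingTwoEffEmpty.ring1_mu_eq_zero_allHeights`: ring 1 carries no charge;
  = probe C `ring1_not_sieveRows₀`, v41 `ShellLedger.shell_one_closed`);
* §3 SHELL 2 CLOSED Hall-free, leg-free, PP-free, from the Chern floor alone, for every `σ ≥ 28·copies` and every rider `π > −28`
  (`PortHallPriceList.ring2_door_shut_of_rankFloor`: `copies + rank ≥ 117` on a charged ring-2 design with `rank ≥ −1`, against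
  `28(copies + rank) ≤ 3248 − π`; rider `0` = probe C `ring2_not_sieveRows₀` with `ShellLedger.copies_add_rank_le_116_of_budget`); in particular at
  the rider of record `π = 0` and at the sheaf door's window of record `I₀ = {4}` (`π = 3136 − windowBudget I₀ = 0`); for a larger window
  (`π ≤ −2436`, `SheafDoorWindowBudget`) this count does NOT close shell 2 — not claimed; in the (8♮) currency `Φ⁺_all` (not `≥ 28·copies`,
  `DoorSPhiShellTwo.not_diag_le_phiAllPlus`) shell 2 is INHABITED (sheaf8-1 g10) — consistent, `hσ` is load-bearing;
* §4 THE LEDGER FROM SHELL 3: `SPlus₀ RD PP h σ π ↔ ⋀_{3 ≤ c ≤ h} RingShell₀ RD PP h σ π c` (`σ ≥ 28·copies`, `π > −28`, `RD ⟹ RULE D`), and the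
  instance of record `hS ↔` its twelve shells `3 … 14` (`hS_iff_shells_from_three`);
* §5 SHELL 3 IN THE v42 CURRENCY, under the three displayed binders (B) (Bu) (M2) of `ShellThreeClosed` as HYPOTHESES ON THE DESIGN: the Hall-free
  floor `51 ≤ Σ_P m` (`pmass_ge_51_of_binders`) against the Chern-floor cap `Σ_P m ≤ 58 − rank ≤ 54` leaves the RESIDUE
  «LEGGED (`¬ EntrySharp`), `4 ≤ rank ≤ 7`, `51 ≤ Σ_P m ≤ 58 − rank`» (`shell3_residue₀_of_binders`); on ENTRY-SHARP designs the leg row gives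
  PortHall₈ back (`PortHallLeg.hallPlusUp_eight_of_hallPlusLegUp`) and the plate `shell3_empty_of_binders` closes; so v42-shell 3 = (binders on the
  shell) + (the legged residue closed) (`ringShell₀_three_of_binders_and_residue`).  HONEST SCOPE: the binders' certificates of record (R19.718 ×-ledger)
  ran at the v41 caps `(58 ∕ 50)` (PortHall₈ regime; dual g21 memo: «to be re-certified at P-cap 54»); on the residue window `51 … 54` they are
  UNCERTIFIED, and nothing here certifies them (g21 typed the window over abstract rows `h24 ∕ h9 ∕ h16` because the shell-3 modules were not
  built then; they are now, so §5 reads it off `pmass_ge_51_of_binders` on the design);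
* §6 CURRENCY TRANSFER per shell: v42-shell ⟹ v41-shell given the PP row and the floor on v41 designs (`ringShellB_of_ringShell₀`, as
  `sPlus_of_sPlus₀`), v41-shell ⟹ v42-shell ON ENTRY-SHARP DESIGNS (`ringShell₀_entrySharp_of_ringShellB`), and the exact difference
  `SPlus₀ RuleD PP h σ π ↔ SPlus h σ π ∧ (no LEGGED design passes the v42 rows)` (`sPlus₀_iff_sPlus_and_legged`);
* §7 monotonicity of rooms ∕ shells in `σ`, `π`, `RD` (a bigger room closed ⟹ the smaller room closed), and the sheaf-door instances (`RD := RuleD♯`,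
  `RowAlpha1.ruleD_of_ruleDSharp`).
What is NOT here: any closure of a shell `≥ 3` of `hS`; any discharge of (B) (Bu) (M2); the shift dictionary for `SPlus₀` (it would need shift-invariance
of `PP`, not in the tree); anything about sheaves, seeds or the SEED item.
-/

set_option linter.dupNamespace false
set_option autoImplicit false

namespace Summit.HodgeConjecture.HodgeConjecture.Cruxes.BlochSeedDiscOne.ShellLedgerV42

open Summit.HodgeConjecture.HodgeConjecture.Cruxes.BlochSeedDiscOne.DepthBoundA4 (Design)
open Summit.HodgeConjecture.HodgeConjecture.Cruxes.BlochSeedDiscOne.LeggedFloor (RuleD Disj)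
open Summit.HodgeConjecture.HodgeConjecture.Cruxes.BlochSeedDiscOne.HallB136 (HallUp)
open Summit.HodgeConjecture.HodgeConjecture.Cruxes.BlochSeedDiscOne.RuleDPlate (HallPlusUp BudgetClause SPlus SPlusB)
open Summit.HodgeConjecture.HodgeConjecture.Cruxes.BlochSeedDiscOne.DeepLayerLaws
  (RingLe TouchesP RingRoomB RingShellB ringLe_mono ringLe_self ringLe_of_not_touchesP exists_full_of_mu_ne one_le_colevel_of_full)
open Summit.HodgeConjecture.HodgeConjecture.Cruxes.BlochSeedDiscOne.SeedChecker.SplitBlock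
  (ScopeRows ShadowRows ShadowRows₀ SieveRows₀ SPlus₀ lawPP shadowRows₀_of_shadowRows sPlus_of_sPlus₀ shadowRows₀_mono_budget
    shadowRows₀_mono_alpha1)
open Summit.HodgeConjecture.HodgeConjecture.Cruxes.BlochSeedDiscOne.SigmaH (sigmaH diag_le_sigmaH)
open Summit.HodgeConjecture.HodgeConjecture.Cruxes.BlochSeedDiscOne.PortHallLeg
  (EntrySharp HallPlusLegUp hallPlusUp_eight_of_hallPlusLegUp)
open Summit.HodgeConjecture.HodgeConjecture.Cruxes.BlochSeedDiscOne.RingTwoEffEmpty (ring1_mu_eq_zero_allHeights)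
open Summit.HodgeConjecture.HodgeConjecture.Cruxes.BlochSeedDiscOne.PortHallPriceList (ring2_door_shut_of_rankFloor pmass_le_of_rankFloor)
open Summit.HodgeConjecture.HodgeConjecture.Cruxes.BlochSeedDiscOne.ShellThreeClosed (Binders pmass_ge_51_of_binders shell3_empty_of_binders)
open Summit.HodgeConjecture.HodgeConjecture.Cruxes.BlochSeedDiscOne.SheafDoorWindowBudget (windowBudget windowBudget_four)

/-! ## §0 Accessors for the v42 sieve rows `SieveRows₀ RD PP h σ π D' = ScopeRows h D' ∧ ShadowRows₀ RD PP σ π D'` -/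

section Access

variable {RD PP : Design → Prop} {h : ℤ} {σ : Design → ℤ} {π : ℤ} {D' : Design}

theorem onAlphabet_of_rows (hr : SieveRows₀ RD PP h σ π D') : D'.OnAlphabet h := hr.1.1
theorem disj_of_rows (hr : SieveRows₀ RD PP h σ π D') : Disj D' := hr.1.2
theorem a1_of_rows (hr : SieveRows₀ RD PP h σ π D') : D'.A1 := hr.2.1
theorem mu_ne_of_rows (hr : SieveRows₀ RD PP h σ π D') : D'.mu ≠ 0 := hr.2.2.1
theorem alpha1_of_rows (hr : SieveRows₀ RD PP h σ π D') : RD D' := hr.2.2.2.1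
theorem hallUp_of_rows (hr : SieveRows₀ RD PP h σ π D') : HallUp D' := hr.2.2.2.2.1
theorem pp_of_rows (hr : SieveRows₀ RD PP h σ π D') : PP D' := hr.2.2.2.2.2.1
theorem leg_of_rows (hr : SieveRows₀ RD PP h σ π D') : HallPlusLegUp D' := hr.2.2.2.2.2.2.1
theorem four_le_rank_of_rows (hr : SieveRows₀ RD PP h σ π D') : 4 ≤ D'.rank := hr.2.2.2.2.2.2.2.1
theorem budget_of_rows (hr : SieveRows₀ RD PP h σ π D') : BudgetClause σ π D' := hr.2.2.2.2.2.2.2.2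

end Access

/-! ## §1 The v42 ring room ∕ ring shell and the ledger -/

/-- **the v42 RING ROOM `c`**: no letter design passing the v42 sieve rows `SieveRows₀ RD PP h σ π` lives in the rings `≤ c`
(all co-levels `≤ c`).  `SPlus₀ RD PP h σ π` is the room `c = h` (`sPlus₀_iff_ringRoom₀`). -/
def RingRoom₀ (RD PP : Design → Prop) (h : ℤ) (σ : Design → ℤ) (π : ℤ) (c : ℤ) : Prop :=
  ∀ D' : Design, SieveRows₀ RD PP h σ π D' → RingLe c D' → False

/-- **the v42 RING SHELL `c`**: the same for designs of the rings `≤ c` that TOUCH ring `c` on the P side. -/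
def RingShell₀ (RD PP : Design → Prop) (h : ℤ) (σ : Design → ℤ) (π : ℤ) (c : ℤ) : Prop :=
  ∀ D' : Design, SieveRows₀ RD PP h σ π D' → RingLe c D' → TouchesP c D' → False

section Ledger

variable {RD PP : Design → Prop} {h : ℤ} {σ : Design → ℤ} {π : ℤ}

theorem ringRoom₀_anti {c c' : ℤ} (hcc : c ≤ c') (H : RingRoom₀ RD PP h σ π c') : RingRoom₀ RD PP h σ π c :=
  fun D' hrows hR => H D' hrows (ringLe_mono hcc hR)

theorem ringShell₀_of_ringRoom₀ {c : ℤ} (H : RingRoom₀ RD PP h σ π c) : RingShell₀ RD PP h σ π c :=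
  fun D' hrows hR _ => H D' hrows hR

/-- `SPlus₀` IS the full ring room `c = h`. -/
theorem sPlus₀_iff_ringRoom₀ : SPlus₀ RD PP h σ π ↔ RingRoom₀ RD PP h σ π h :=
  ⟨fun H D' hrows _ => H D' hrows, fun H D' hrows => H D' hrows (ringLe_self (onAlphabet_of_rows hrows))⟩

theorem ringRoom₀_of_sPlus₀ (H : SPlus₀ RD PP h σ π) (c : ℤ) : RingRoom₀ RD PP h σ π c :=
  fun D' hrows _ => H D' hrows

theorem shells_of_sPlus₀ (H : SPlus₀ RD PP h σ π) (c : ℤ) : RingShell₀ RD PP h σ π c :=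
  fun D' hrows _ _ => H D' hrows

/-- **RING 0 IS EMPTY** (every `RD`, `PP`, `σ`, `π`): `μ ≠ 0` needs a fully charged cell, whose co-levels are `≥ 1`. -/
theorem ringRoom₀_zero (RD PP : Design → Prop) (h : ℤ) (σ : Design → ℤ) (π : ℤ) : RingRoom₀ RD PP h σ π 0 := by
  intro D' hrows hR
  have hA := onAlphabet_of_rows hrows
  obtain ⟨c, hc, hfull⟩ := exists_full_of_mu_ne D' hA (mu_ne_of_rows hrows)
  have h1 := one_le_colevel_of_full (hA c hc) hfull 0
  have h0 := hR c hc 0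
  omega

/-- **THE LEDGER STEP** (needs the α1 slot to imply RULE D, for `DeepLayerLaws.ringLe_of_not_touchesP`): closing ring `c + 1` on top of the rings
`≤ c` is exactly closing the `c + 1` shell. -/
theorem ringRoom₀_succ_iff (hRD : ∀ D : Design, RD D → RuleD D) {c : ℤ} (hc : 0 ≤ c) :
    RingRoom₀ RD PP h σ π (c + 1) ↔ RingRoom₀ RD PP h σ π c ∧ RingShell₀ RD PP h σ π (c + 1) := by
  constructor
  · intro H
    exact ⟨ringRoom₀_anti (by omega) H, ringShell₀_of_ringRoom₀ H⟩
  · rintro ⟨HR, HS⟩ D' hrows hR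
    by_cases ht : TouchesP (c + 1) D'
    · exact HS D' hrows hR ht
    · exact HR D' hrows (ringLe_of_not_touchesP (onAlphabet_of_rows hrows) (disj_of_rows hrows)
        (hRD D' (alpha1_of_rows hrows)) hc hR ht)

/-- the ledger as a finite conjunction: all shells `1 … n` closed ⟹ the ring room `n` closed. -/
theorem ringRoom₀_of_shells (hRD : ∀ D : Design, RD D → RuleD D) :
    ∀ n : ℕ, (∀ c : ℤ, 1 ≤ c → c ≤ n → RingShell₀ RD PP h σ π c) → RingRoom₀ RD PP h σ π n := by
  intro n
  induction n with
  | zero => intro _; exact_mod_cast ringRoom₀_zero RD PP h σ π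
  | succ m ih =>
    intro hS
    have hm : RingRoom₀ RD PP h σ π (m : ℤ) := ih fun c h1 h2 => hS c h1 (by push_cast; omega)
    have step := (ringRoom₀_succ_iff (PP := PP) (h := h) (σ := σ) (π := π) hRD (c := (m : ℤ)) (by positivity)).mpr
      ⟨hm, hS ((m : ℤ) + 1) (by omega) (by push_cast; omega)⟩
    exact_mod_cast step

theorem sPlus₀_of_shells (hRD : ∀ D : Design, RD D → RuleD D) (hh : 0 ≤ h)
    (hS : ∀ c : ℤ, 1 ≤ c → c ≤ h → RingShell₀ RD PP h σ π c) : SPlus₀ RD PP h σ π := by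
  rw [sPlus₀_iff_ringRoom₀]
  obtain ⟨n, rfl⟩ := Int.eq_ofNat_of_zero_le hh
  exact ringRoom₀_of_shells hRD n hS

/-- **`SPlus₀ RD PP h σ π ↔ ⋀_{1 ≤ c ≤ h} RingShell₀ RD PP h σ π c`** (`0 ≤ h`, `RD ⟹ RULE D`). -/
theorem sPlus₀_iff_shells (hRD : ∀ D : Design, RD D → RuleD D) (hh : 0 ≤ h) :
    SPlus₀ RD PP h σ π ↔ ∀ c : ℤ, 1 ≤ c → c ≤ h → RingShell₀ RD PP h σ π c :=
  ⟨fun H c _ _ => shells_of_sPlus₀ H c, sPlus₀_of_shells hRD hh⟩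

end Ledger

/-! ## §2 SHELL 1 is closed (ring 1 carries no charge) -/

section ShellOne

variable {RD PP : Design → Prop} {h : ℤ} {σ : Design → ℤ} {π : ℤ}

/-- **RING ROOM 1 CLOSED** for every α1 slot implying RULE D, every `PP`, `σ`, `π`: `μ = 0` on ring 1 (`RingTwoEffEmpty.ring1_mu_eq_zero_allHeights`,
which uses only the alphabet, `Disj` and RULE D; hsem-2 probe C `ring1_not_sieveRows₀`, same proof). -/
theorem ringRoom₀_one (hRD : ∀ D : Design, RD D → RuleD D) : RingRoom₀ RD PP h σ π 1 :=
  fun D' hrows hR => mu_ne_of_rows hrows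
    (ring1_mu_eq_zero_allHeights (onAlphabet_of_rows hrows) hR (disj_of_rows hrows) (hRD D' (alpha1_of_rows hrows)))

theorem ringShell₀_one (hRD : ∀ D : Design, RD D → RuleD D) : RingShell₀ RD PP h σ π 1 :=
  ringShell₀_of_ringRoom₀ (ringRoom₀_one hRD)

end ShellOne

/-! ## §3 SHELL 2 is closed from the Chern floor alone (Hall-free, leg-free, PP-free) -/

section ShellTwo

variable {RD PP : Design → Prop} {h : ℤ} {σ : Design → ℤ} {π : ℤ}

/-- on a design passing the v42 rows and living in the rings `≤ 2`: `116 < copies + rank` (`PortHallPriceList.ring2_door_shut_of_rankFloor`, fed the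
rank floor `−1 ≤ rank` from the Chern floor `4 ≤ rank`; the Hall, PP, leg and budget rows are not used). -/
theorem copies_add_rank_gt_116_of_rows_ring2 (hRD : ∀ D : Design, RD D → RuleD D) {D' : Design}
    (hrows : SieveRows₀ RD PP h σ π D') (hR : RingLe 2 D') : 116 < (D'.copies : ℤ) + D'.rank :=
  ring2_door_shut_of_rankFloor (onAlphabet_of_rows hrows) hR (disj_of_rows hrows) (hRD D' (alpha1_of_rows hrows))
    (a1_of_rows hrows) (mu_ne_of_rows hrows) (by have h4 := four_le_rank_of_rows hrows; omega)

/-- the budget row of a functional `σ ≥ 28·copies` with rider `π > −28` gives `copies + rank ≤ 116`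
(`28(copies + rank) ≤ 3248 − π < 3276 = 28·117`; rider `0`: `ShellLedger.copies_add_rank_le_116_of_budget`). -/
theorem copies_add_rank_le_116_of_budget_rider {σ : Design → ℤ} {π : ℤ} {D' : Design} (hσ : 28 * (D'.copies : ℤ) ≤ σ D') (hπ : -28 < π)
    (hb : BudgetClause σ π D') : (D'.copies : ℤ) + D'.rank ≤ 116 := by
  unfold RuleDPlate.BudgetClause at hb
  omega

/-- **RING ROOM 2 CLOSED** for every `σ ≥ 28·copies`, every rider `π > −28`, every α1 slot implying RULE D and every `PP`
(rider `0`: hsem-2 probe C `ring2_not_sieveRows₀`, same two citations). -/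
theorem ringRoom₀_two (hRD : ∀ D : Design, RD D → RuleD D) (hσ : ∀ D : Design, 28 * (D.copies : ℤ) ≤ σ D) (hπ : -28 < π) :
    RingRoom₀ RD PP h σ π 2 := by
  intro D' hrows hR
  have hgt := copies_add_rank_gt_116_of_rows_ring2 hRD hrows hR
  have hle := copies_add_rank_le_116_of_budget_rider (hσ D') hπ (budget_of_rows hrows)
  omega

theorem ringShell₀_two (hRD : ∀ D : Design, RD D → RuleD D) (hσ : ∀ D : Design, 28 * (D.copies : ℤ) ≤ σ D) (hπ : -28 < π) :
    RingShell₀ RD PP h σ π 2 :=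
  ringShell₀_of_ringRoom₀ (ringRoom₀_two hRD hσ hπ)

/-- the currency of record `σ_H` (`SigmaH.diag_le_sigmaH : 28·copies ≤ σ_H`), rider `π = 0`. -/
theorem ringRoom₀_two_sigmaH (hRD : ∀ D : Design, RD D → RuleD D) : RingRoom₀ RD PP h sigmaH 0 2 :=
  ringRoom₀_two hRD diag_le_sigmaH (by norm_num)

end ShellTwo

/-! ## §4 THE LEDGER FROM SHELL 3, and the instance of record `hS` -/

section FromThree

variable {RD PP : Design → Prop} {h : ℤ} {σ : Design → ℤ} {π : ℤ}

/-- **`SPlus₀ RD PP h σ π ↔ ⋀_{3 ≤ c ≤ h} RingShell₀ RD PP h σ π c`**: shells 1 and 2 are closed in kernel (§2, §3), so the v42 closed room is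
exactly the conjunction of its shells `3 … h` (`σ ≥ 28·copies`, `π > −28`, `RD ⟹ RULE D`, `0 ≤ h`). -/
theorem sPlus₀_iff_shells_from_three (hRD : ∀ D : Design, RD D → RuleD D) (hσ : ∀ D : Design, 28 * (D.copies : ℤ) ≤ σ D)
    (hπ : -28 < π) (hh : 0 ≤ h) :
    SPlus₀ RD PP h σ π ↔ ∀ c : ℤ, 3 ≤ c → c ≤ h → RingShell₀ RD PP h σ π c := by
  rw [sPlus₀_iff_shells hRD hh]
  constructor
  · intro H c h3 hch
    exact H c (by omega) hch
  · intro H c h1 hch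
    rcases (show c = 1 ∨ c = 2 ∨ 3 ≤ c by omega) with rfl | rfl | h3
    · exact ringShell₀_one hRD
    · exact ringShell₀_two hRD hσ hπ
    · exact H c h3 hch

/-- the two closed shells, bundled: the ring room 2 of `SPlus₀` is closed. -/
theorem ringRoom₀_le_two (hRD : ∀ D : Design, RD D → RuleD D) (hσ : ∀ D : Design, 28 * (D.copies : ℤ) ≤ σ D) (hπ : -28 < π)
    {c : ℤ} (hc : c ≤ 2) : RingRoom₀ RD PP h σ π c :=
  ringRoom₀_anti hc (ringRoom₀_two hRD hσ hπ)

end FromThree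

/-- **THE INSTANCE OF RECORD.**  The kill hypothesis `hS : SPlus₀ LeggedFloor.RuleD lawPP 14 σ_H 0` of `Lines/splitblock.lean`
(`not_rung2a₀Under_recordPic_sigmaH` and twins) is EXACTLY the conjunction of its twelve shells `3 … 14`; shells 1, 2 are kernel-closed
(§2, §3).  None of the twelve is closed here or anywhere in the tree (R19.853). -/
theorem hS_iff_shells_from_three :
    SPlus₀ RuleD lawPP 14 sigmaH 0 ↔ ∀ c : ℤ, 3 ≤ c → c ≤ 14 → RingShell₀ RuleD lawPP 14 sigmaH 0 c :=
  sPlus₀_iff_shells_from_three (fun _ hr => hr) diag_le_sigmaH (by norm_num) (by norm_num)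

/-- the same for any LAW PP slot and any `σ ≥ 28·copies` at the rider of record. -/
theorem sPlus₀_ruleD_iff_shells_from_three (PP : Design → Prop) {h : ℤ} (hh : 0 ≤ h) (σ : Design → ℤ)
    (hσ : ∀ D : Design, 28 * (D.copies : ℤ) ≤ σ D) :
    SPlus₀ RuleD PP h σ 0 ↔ ∀ c : ℤ, 3 ≤ c → c ≤ h → RingShell₀ RuleD PP h σ 0 c :=
  sPlus₀_iff_shells_from_three (fun _ hr => hr) hσ (by norm_num) hh

/-! ## §5 SHELL 3 in the v42 currency: the binders leave the LEGGED residue `4 ≤ rank ≤ 7`, `51 ≤ Σ_P m ≤ 58 − rank` -/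

section ShellThree

variable {RD PP : Design → Prop} {h : ℤ} {σ : Design → ℤ} {π : ℤ}

/-- the budget clause is antitone in the rider. -/
theorem budgetClause_mono_pi {σ : Design → ℤ} {π π' : ℤ} (hle : π' ≤ π) {D' : Design} (hb : BudgetClause σ π D') :
    BudgetClause σ π' D' := by
  unfold RuleDPlate.BudgetClause at hb ⊢
  omega

/-- **THE SHELL-3 RESIDUE OF THE v42 ROOM UNDER THE BINDERS.**  A design passing the v42 rows (`σ ≥ 28·copies`, rider `π ≥ 0`), living in the
rings `≤ 3`, and satisfying the three displayed binders (B) (Bu) (M2) of `ShellThreeClosed` (HYPOTHESES on the design) has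
`51 ≤ Σ_P m` (the Hall-free floor `pmass_ge_51_of_binders`), `Σ_P m + rank ≤ 58` (budget), hence `rank ≤ 7` and `Σ_P m ≤ 54` (Chern floor),
and is LEGGED: on an entry-sharp design the leg row is PortHall₈ (`hallPlusUp_eight_of_hallPlusLegUp`) and the plate `shell3_empty_of_binders`
closes.  (The binders' certificates of record, R19.718, ran at the v41 caps `(58 ∕ 50)`; on this window they are uncertified — g21: «to be
re-certified at P-cap 54» — and they enter here as hypotheses only.) -/
theorem shell3_residue₀_of_binders (hRD : ∀ D : Design, RD D → RuleD D) {D' : Design} (hσ : 28 * (D'.copies : ℤ) ≤ σ D') (hπ : 0 ≤ π)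
    (hrows : SieveRows₀ RD PP h σ π D') (hR : RingLe 3 D') (hBi : Binders h D') :
    51 ≤ (((D'.P.map Prod.snd).sum : ℕ) : ℤ) ∧ (((D'.P.map Prod.snd).sum : ℕ) : ℤ) + D'.rank ≤ 58 ∧ D'.rank ≤ 7 ∧
      (((D'.P.map Prod.snd).sum : ℕ) : ℤ) ≤ 54 ∧ ¬ EntrySharp D' := by
  obtain ⟨hB, hBu, hM2⟩ := hBi
  have hA := onAlphabet_of_rows hrows
  have hd := disj_of_rows hrows
  have h1 := a1_of_rows hrows
  have hr : RuleD D' := hRD D' (alpha1_of_rows hrows)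
  have hμ := mu_ne_of_rows hrows
  have h4 := four_le_rank_of_rows hrows
  have hb0 : BudgetClause σ 0 D' := budgetClause_mono_pi hπ (budget_of_rows hrows)
  have h51 := pmass_ge_51_of_binders hB hBu hM2 hA hd h1 hr hμ hR
  have hrk := pmass_le_of_rankFloor σ hσ hb0 (le_refl D'.rank)
  refine ⟨h51, by omega, by omega, by omega, ?_⟩
  intro hE
  exact shell3_empty_of_binders σ hσ hB hBu hM2 hA hd h1 hr (hallPlusUp_eight_of_hallPlusLegUp D' hE (leg_of_rows hrows)) hμ hb0 hR

/-- **v42-SHELL 3 IS CLOSED ON ENTRY-SHARP DESIGNS under the binders** (`σ ≥ 28·copies`, `π ≥ 0`). -/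
theorem shell3_closed₀_entrySharp_of_binders (hRD : ∀ D : Design, RD D → RuleD D) (hσ : ∀ D : Design, 28 * (D.copies : ℤ) ≤ σ D)
    (hπ : 0 ≤ π) :
    ∀ D' : Design, Binders h D' → EntrySharp D' → SieveRows₀ RD PP h σ π D' → RingLe 3 D' → False :=
  fun D' hBi hE hrows hR => (shell3_residue₀_of_binders hRD (hσ D') hπ hrows hR hBi).2.2.2.2 hE

/-- **… and ON DESIGNS OF RANK `≥ 8` under the binders** (any source of `8 ≤ rank`; legs irrelevant). -/
theorem shell3_closed₀_rank8_of_binders (hRD : ∀ D : Design, RD D → RuleD D) (hσ : ∀ D : Design, 28 * (D.copies : ℤ) ≤ σ D)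
    (hπ : 0 ≤ π) :
    ∀ D' : Design, Binders h D' → 8 ≤ D'.rank → SieveRows₀ RD PP h σ π D' → RingLe 3 D' → False :=
  fun D' hBi h8 hrows hR => by
    have h7 := (shell3_residue₀_of_binders hRD (hσ D') hπ hrows hR hBi).2.2.1
    omega

/-- **v42-SHELL 3 = (the binders on the shell) + (the LEGGED RESIDUE closed).**  If the binders hold on every design of the v42 shell 3, and no
LEGGED design of rank `≤ 7` with `51 ≤ Σ_P m ≤ 58 − rank` passes the v42 rows in shell 3, then `RingShell₀ RD PP h σ π 3`.  Both hypotheses are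
OPEN (no certificate of record covers the window `Σ_P m ∈ [51, 54]`). -/
theorem ringShell₀_three_of_binders_and_residue (hRD : ∀ D : Design, RD D → RuleD D)
    (hσ : ∀ D : Design, 28 * (D.copies : ℤ) ≤ σ D) (hπ : 0 ≤ π)
    (HB : ∀ D' : Design, SieveRows₀ RD PP h σ π D' → RingLe 3 D' → TouchesP 3 D' → Binders h D')
    (HRes : ∀ D' : Design, SieveRows₀ RD PP h σ π D' → RingLe 3 D' → TouchesP 3 D' → ¬ EntrySharp D' → D'.rank ≤ 7 →
      51 ≤ (((D'.P.map Prod.snd).sum : ℕ) : ℤ) → (((D'.P.map Prod.snd).sum : ℕ) : ℤ) + D'.rank ≤ 58 → False) :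
    RingShell₀ RD PP h σ π 3 := by
  intro D' hrows hR ht
  obtain ⟨h51, h58, h7, -, hE⟩ := shell3_residue₀_of_binders hRD (hσ D') hπ hrows hR (HB D' hrows hR ht)
  exact HRes D' hrows hR ht hE h7 h51 h58

/-- conversely the residue hypothesis is NECESSARY: it is an instance of the shell. -/
theorem residue_of_ringShell₀_three (H : RingShell₀ RD PP h σ π 3) :
    ∀ D' : Design, SieveRows₀ RD PP h σ π D' → RingLe 3 D' → TouchesP 3 D' → ¬ EntrySharp D' → D'.rank ≤ 7 →
      51 ≤ (((D'.P.map Prod.snd).sum : ℕ) : ℤ) → (((D'.P.map Prod.snd).sum : ℕ) : ℤ) + D'.rank ≤ 58 → False :=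
  fun D' hrows hR ht _ _ _ _ => H D' hrows hR ht

end ShellThree

/-! ## §6 CURRENCY TRANSFER v41 (`RingShellB h (BudgetClause σ π) c`, PortHall₈) ↔ v42 (`RingShell₀ RD PP h σ π c`, leg row + Chern floor) -/

section Transfer

variable {RD PP : Design → Prop} {h : ℤ} {σ : Design → ℤ} {π : ℤ}

/-- **v42 ⟹ v41 per ring room** (α1 slot `RuleD`): given the PP row and the Chern floor on every design passing the v41 shadow rows
(hypotheses, as in `SplitBlock.sPlus_of_sPlus₀`), a closed v42 ring room closes the v41 ring room (PortHall₈ ⟹ the leg row). -/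
theorem ringRoomB_of_ringRoom₀ (hPP : ∀ D' : Design, ShadowRows σ π D' → PP D') (h4 : ∀ D' : Design, ShadowRows σ π D' → 4 ≤ D'.rank)
    {c : ℤ} (H : RingRoom₀ RuleD PP h σ π c) : RingRoomB h (BudgetClause σ π) c := by
  intro D' hA hd h1 hr hu hp hμ hb hR
  have hsh : ShadowRows σ π D' := ⟨h1, hr, hu, hp, hμ, hb⟩
  exact H D' ⟨⟨hA, hd⟩, shadowRows₀_of_shadowRows hsh (hPP D' hsh) (h4 D' hsh)⟩ hR

/-- **v42 ⟹ v41 per shell.** -/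
theorem ringShellB_of_ringShell₀ (hPP : ∀ D' : Design, ShadowRows σ π D' → PP D') (h4 : ∀ D' : Design, ShadowRows σ π D' → 4 ≤ D'.rank)
    {c : ℤ} (H : RingShell₀ RuleD PP h σ π c) : RingShellB h (BudgetClause σ π) c := by
  intro D' hA hd h1 hr hu hp hμ hb hR ht
  have hsh : ShadowRows σ π D' := ⟨h1, hr, hu, hp, hμ, hb⟩
  exact H D' ⟨⟨hA, hd⟩, shadowRows₀_of_shadowRows hsh (hPP D' hsh) (h4 D' hsh)⟩ hR ht

/-- **v41 ⟹ v42 per ring room ON ENTRY-SHARP DESIGNS** (every α1 slot implying RULE D, every `PP`): on an entry-sharp design the leg row IS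
PortHall₈ (`PortHallLeg.hallPlusUp_eight_of_hallPlusLegUp`), so the v41 closure applies. -/
theorem ringRoom₀_entrySharp_of_ringRoomB (hRD : ∀ D : Design, RD D → RuleD D) {c : ℤ} (H : RingRoomB h (BudgetClause σ π) c) :
    ∀ D' : Design, EntrySharp D' → SieveRows₀ RD PP h σ π D' → RingLe c D' → False :=
  fun D' hE hrows hR => H D' (onAlphabet_of_rows hrows) (disj_of_rows hrows) (a1_of_rows hrows) (hRD D' (alpha1_of_rows hrows))
    (hallUp_of_rows hrows) (hallPlusUp_eight_of_hallPlusLegUp D' hE (leg_of_rows hrows)) (mu_ne_of_rows hrows) (budget_of_rows hrows) hR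

/-- **v41 ⟹ v42 per shell ON ENTRY-SHARP DESIGNS.** -/
theorem ringShell₀_entrySharp_of_ringShellB (hRD : ∀ D : Design, RD D → RuleD D) {c : ℤ} (H : RingShellB h (BudgetClause σ π) c) :
    ∀ D' : Design, EntrySharp D' → SieveRows₀ RD PP h σ π D' → RingLe c D' → TouchesP c D' → False :=
  fun D' hE hrows hR ht => H D' (onAlphabet_of_rows hrows) (disj_of_rows hrows) (a1_of_rows hrows) (hRD D' (alpha1_of_rows hrows))
    (hallUp_of_rows hrows) (hallPlusUp_eight_of_hallPlusLegUp D' hE (leg_of_rows hrows)) (mu_ne_of_rows hrows) (budget_of_rows hrows) hR ht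

/-- at statement level: the v41 statement `S⁺(h; σ, π)` forbids every ENTRY-SHARP design passing the v42 rows. -/
theorem not_sieveRows₀_entrySharp_of_sPlus (hRD : ∀ D : Design, RD D → RuleD D) (H : SPlus h σ π) {D' : Design} (hE : EntrySharp D') :
    ¬ SieveRows₀ RD PP h σ π D' :=
  fun hrows => H D' (onAlphabet_of_rows hrows) (disj_of_rows hrows) (a1_of_rows hrows) (hRD D' (alpha1_of_rows hrows))
    (hallUp_of_rows hrows) (hallPlusUp_eight_of_hallPlusLegUp D' hE (leg_of_rows hrows)) (mu_ne_of_rows hrows) (budget_of_rows hrows)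

/-- **THE EXACT DIFFERENCE OF THE TWO CURRENCIES** (α1 slot `RuleD`; PP row and Chern floor on v41 designs as hypotheses): the v42 closed room is
the v41 closed room `S⁺(h; σ, π)` AND «no LEGGED (not entry-sharp) design passes the v42 rows». -/
theorem sPlus₀_iff_sPlus_and_legged (hPP : ∀ D' : Design, ShadowRows σ π D' → PP D')
    (h4 : ∀ D' : Design, ShadowRows σ π D' → 4 ≤ D'.rank) :
    SPlus₀ RuleD PP h σ π ↔ SPlus h σ π ∧ ∀ D' : Design, ¬ EntrySharp D' → ¬ SieveRows₀ RuleD PP h σ π D' := by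
  constructor
  · intro hS
    exact ⟨sPlus_of_sPlus₀ hPP h4 hS, fun D' _ => hS D'⟩
  · rintro ⟨HS, HL⟩ D' hrows
    by_cases hE : EntrySharp D'
    · exact not_sieveRows₀_entrySharp_of_sPlus (RD := RuleD) (fun _ hr => hr) HS hE hrows
    · exact HL D' hE hrows

/-- per shell: v42-shell `c` ⟺ v41-shell `c` ∧ (its legged part), under the same hypotheses. -/
theorem ringShell₀_iff_ringShellB_and_legged (hPP : ∀ D' : Design, ShadowRows σ π D' → PP D')
    (h4 : ∀ D' : Design, ShadowRows σ π D' → 4 ≤ D'.rank) (c : ℤ) :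
    RingShell₀ RuleD PP h σ π c ↔ RingShellB h (BudgetClause σ π) c ∧
      ∀ D' : Design, ¬ EntrySharp D' → SieveRows₀ RuleD PP h σ π D' → RingLe c D' → TouchesP c D' → False := by
  constructor
  · intro H
    exact ⟨ringShellB_of_ringShell₀ hPP h4 H, fun D' _ => H D'⟩
  · rintro ⟨HS, HL⟩ D' hrows hR ht
    by_cases hE : EntrySharp D'
    · exact ringShell₀_entrySharp_of_ringShellB (RD := RuleD) (fun _ hr => hr) HS D' hE hrows hR ht
    · exact HL D' hE hrows hR ht

end Transfer

/-! ## §7 Monotonicity (a bigger room closed ⟹ the smaller room closed) and the sheaf-door instances -/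

section Mono

variable {RD RD' PP : Design → Prop} {h : ℤ} {Φ σ : Design → ℤ} {π π' : ℤ} {c : ℤ}

/-- a SMALLER budget functional is a WEAKER row, i.e. a BIGGER room: closing the `Φ`-room closes the `σ`-room for `Φ ≤ σ`. -/
theorem ringShell₀_mono_budget (hle : ∀ D : Design, Φ D ≤ σ D) (H : RingShell₀ RD PP h Φ π c) : RingShell₀ RD PP h σ π c :=
  fun D' hrows hR ht => H D' ⟨hrows.1, shadowRows₀_mono_budget hle hrows.2⟩ hR ht

/-- a SMALLER rider is a weaker row: closing the `π'`-room closes the `π`-room for `π' ≤ π`. -/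
theorem ringShell₀_mono_pi (hle : π' ≤ π) (H : RingShell₀ RD PP h σ π' c) : RingShell₀ RD PP h σ π c := by
  intro D' hrows hR ht
  obtain ⟨hsc, h1, hμ, hd, hu, hp, hl, hk, hb⟩ := hrows
  exact H D' ⟨hsc, h1, hμ, hd, hu, hp, hl, hk, budgetClause_mono_pi hle hb⟩ hR ht

/-- a WEAKER α1 row is a bigger room: closing the `RD'`-room closes the `RD`-room for `RD ⟹ RD'` (e.g. `RuleD♯ ⟹ RuleD`). -/
theorem ringShell₀_mono_alpha1 (hle : ∀ D : Design, RD D → RD' D) (H : RingShell₀ RD' PP h σ π c) : RingShell₀ RD PP h σ π c :=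
  fun D' hrows hR ht => H D' ⟨hrows.1, shadowRows₀_mono_alpha1 hle hrows.2⟩ hR ht

theorem sPlus₀_mono_pi (hle : π' ≤ π) (H : SPlus₀ RD PP h σ π') : SPlus₀ RD PP h σ π := by
  intro D' hrows
  obtain ⟨hsc, h1, hμ, hd, hu, hp, hl, hk, hb⟩ := hrows
  exact H D' ⟨hsc, h1, hμ, hd, hu, hp, hl, hk, budgetClause_mono_pi hle hb⟩

end Mono

section SheafDoor

/-- **SHEAF DOOR, SHELL 1**: closed for the α1 row `RuleD♯` of hsem-3 (`RowAlpha1.ruleD_of_ruleDSharp`), every `PP`, `σ`, and every window rider. -/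
theorem sheafDoor_ringShell₀_one (PP : Design → Prop) (h : ℤ) (σ : Design → ℤ) (π : ℤ) :
    RingShell₀ RowAlpha1.RuleDSharp PP h σ π 1 :=
  ringShell₀_one RowAlpha1.ruleD_of_ruleDSharp

/-- **SHEAF DOOR, SHELL 2 AT THE WINDOW OF RECORD `I₀ = {4}`** (`windowBudget {4} = 3136`, rider `π = 3136 − 3136 = 0 > −28`), currency `σ_H`. -/
theorem sheafDoor_ringShell₀_two_windowFour (PP : Design → Prop) (h : ℤ) :
    RingShell₀ RowAlpha1.RuleDSharp PP h sigmaH (3136 - (windowBudget {4} : ℤ)) 2 :=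
  ringShell₀_two RowAlpha1.ruleD_of_ruleDSharp diag_le_sigmaH (by rw [windowBudget_four]; norm_num)

/-- the sheaf door's room at the window of record is, like `hS`, the conjunction of its shells `3 … h` (`0 ≤ h`). -/
theorem sheafDoor_sPlus₀_iff_shells_from_three (PP : Design → Prop) {h : ℤ} (hh : 0 ≤ h) :
    SPlus₀ RowAlpha1.RuleDSharp PP h sigmaH (3136 - (windowBudget {4} : ℤ)) ↔
      ∀ c : ℤ, 3 ≤ c → c ≤ h → RingShell₀ RowAlpha1.RuleDSharp PP h sigmaH (3136 - (windowBudget {4} : ℤ)) c :=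
  sPlus₀_iff_shells_from_three RowAlpha1.ruleD_of_ruleDSharp diag_le_sigmaH (by rw [windowBudget_four]; norm_num) hh

end SheafDoor

end Summit.HodgeConjecture.HodgeConjecture.Cruxes.BlochSeedDiscOne.ShellLedgerV42
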